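import Literature.Topology.FourManifolds.TwoHandleTubeCoordinates
import Literature.AlgebraicTopology.SingularHomology.EulerCharacteristicTriple
import Literature.AlgebraicTopology.SingularHomology.HomologySpheresProofs
import Literature.Topology.FourManifolds.TrisectionEulerProofs
import Mathlib.Analysis.Convex.Contractible
import Mathlib.Analysis.Normed.Module.Connected
import HarnessLib

/-!
# Euler characteristics of the model pieces of a 2-handle: `χ(T) = χ(T ∖ S) = 0`, `χ(D ∖ S) = 1`
(helper of sub-goal `stub_modelsOn_counts_length_of_betti` of stub `stub_modelsOn_counts`, line
`modp-braid-orbits`, reshape r9, crux `ConvexBisection.AcyclicBisectionExists`, item stmt-SmoothPoincare4-10508)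

Kosinski, *Differential Manifolds* (1993), VI §6, attaches a 2-handle to `V` by gluing `V ∖ h̄(S)` and the
handle piece `D ∖ S` along the punctured tube `T ∖ S` (`HandleAttachingMaps.lean`; dimension `m + 2`,
coordinates `x = (x_λ, x_μ)` of `TwoHandleTubeCoordinates.lean`).  The count `χ(V ∪ n H²) = χ(V) + n` behind the
first clause of `LefschetzBase.modelsOn_counts_of_homotopyEquiv_sphere` (Gompf–Stipsicz 1999, §8.2) is an
inclusion–exclusion over these pieces (companion `…EulerHandles.lean`, which takes the four values below as
inputs); this file PROVES the values with their finiteness data (`FinRelHomology`, `relEuler ℤ ℤ · ∅`):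

* `finRelHomology_and_relEuler_handleTube` — **`χ(T) = 0`**; `…_handleTube_punctured` — **`χ(T ∖ S) = 0`**;
  `…_beltPiece_punctured` — **`χ = 0` for the gluing region `{x_λ ≠ 0}` of `D ∖ S`**: copies of model tubes
  `{‖x‖ ≤ 1, 0 < ‖x_λ‖ < b}`, which retract by straight lines onto the circle `{(θ/2, 0)}`
  (`nonempty_homotopyEquiv_tube_circle`), and `χ(S¹) = 0` (Hatcher 2002, Cor. 2.14, `isHomologySphere_sphere`);
* `finRelHomology_and_relEuler_beltPiece` — **`χ(D ∖ S) = 1`**: star-shaped, hence contractible.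

Everything is proved; no definitions, no named facts, no `sorry`.
-/

noncomputable section

-- the prescribed namespace `Summit.<P>.<Sub>.…` duplicates `SmoothPoincare4` (P = Sub)
set_option linter.dupNamespace false

open scoped Manifold ContDiff Topology ContinuousMap unitInterval
open Set Function Metric CategoryTheory CategoryTheory.Limits
open Literature.AlgebraicTopology.SingularHomology Literature.Topology.FourManifolds

namespace Summit.SmoothPoincare4.SmoothPoincare4.Theorems.AcyclicBisectionExists.ModpBraidOrbits

/-! ## Euler characteristics along homotopy equivalences; the circle; contractible spaces -/

section General

/-- Homotopy equivalent spaces (same universe) have the same finiteness datum and the same Euler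
characteristic (Hatcher 2002, Cor. 2.11: `H_•(X) ≅ H_•(Y)`, the tree's `singularHomology.isoOfHomotopyEquiv`).
[folklore] -/
theorem finRelHomology_and_relEuler_of_homotopyEquiv {X Y : Type} [TopologicalSpace X] [TopologicalSpace Y]
    (e : X ≃ₕ Y) {N : ℕ} (h : FinRelHomology ℤ ℤ Y ∅ N) :
    FinRelHomology ℤ ℤ X ∅ N ∧ relEuler ℤ ℤ X ∅ = relEuler ℤ ℤ Y ∅ := by
  let ek : ∀ k, relativeSingularHomology ℤ ℤ X ∅ k ≅ relativeSingularHomology ℤ ℤ Y ∅ k := fun k =>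
    (relativeSingularHomology.emptyIso ℤ ℤ X k).symm ≪≫ singularHomology.isoOfHomotopyEquiv ℤ ℤ e k ≪≫
      relativeSingularHomology.emptyIso ℤ ℤ Y k
  exact ⟨h.of_iso fun k => (ek k).symm, relEuler_eq_of_iso ek⟩

/-- **`χ(S¹) = 0`** with finiteness: `H_•(S¹; ℤ) = ℤ, ℤ, 0, …` (Hatcher 2002, Cor. 2.14; the tree's
`isHomologySphere_sphere`, `singularHomology.isIso_ε_of_pathConnectedSpace`). [folklore] -/
theorem finRelHomology_and_relEuler_circle :
    FinRelHomology ℤ ℤ (Metric.sphere (0 : EuclideanSpace ℝ (Fin 2)) 1) ∅ 2 ∧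
      relEuler ℤ ℤ (Metric.sphere (0 : EuclideanSpace ℝ (Fin 2)) 1) ∅ = 0 := by
  have hS : IsHomologySphere (Metric.sphere (0 : EuclideanSpace ℝ (Fin 2)) 1) 1 :=
    isHomologySphere_sphere (n := 1) le_rfl
  haveI : PathConnectedSpace (Metric.sphere (0 : EuclideanSpace ℝ (Fin 2)) 1) := by
    refine isPathConnected_iff_pathConnectedSpace.mp (isPathConnected_sphere ?_ 0 zero_le_one)
    rw [← Module.finrank_eq_rank, finrank_euclideanSpace_fin]
    exact Nat.one_lt_cast.mpr (by norm_num)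
  haveI := singularHomology.isIso_ε_of_pathConnectedSpace ℤ ℤ
    (X := Metric.sphere (0 : EuclideanSpace ℝ (Fin 2)) 1)
  let e0 : singularHomology ℤ ℤ (Metric.sphere (0 : EuclideanSpace ℝ (Fin 2)) 1) 0 ≅
      ModuleCat.of ℤ (ULift.{0} ℤ) :=
    asIso (singularHomology.ε ℤ ℤ (Metric.sphere (0 : EuclideanSpace ℝ (Fin 2)) 1))
  let e1 : singularHomology ℤ ℤ (Metric.sphere (0 : EuclideanSpace ℝ (Fin 2)) 1) 1 ≅
      ModuleCat.of ℤ (ULift.{0} ℤ) := hS.nonempty_iso.some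
  have hZ : ∀ k, 2 ≤ k → IsZero (singularHomology ℤ ℤ (Metric.sphere (0 : EuclideanSpace ℝ (Fin 2)) 1) k) :=
    fun k hk => hS.1 k (by omega) (by omega)
  have hfin : ∀ k, Module.Finite ℤ (singularHomology ℤ ℤ (Metric.sphere (0 : EuclideanSpace ℝ (Fin 2)) 1) k) := by
    intro k
    rcases Nat.lt_or_ge k 2 with hk | hk
    · interval_cases k
      · exact Module.Finite.equiv e0.toLinearEquiv.symm
      · exact Module.Finite.equiv e1.toLinearEquiv.symm
    · exact finite_of_isZero (hZ k hk)
  have h : FinRelHomology ℤ ℤ (Metric.sphere (0 : EuclideanSpace ℝ (Fin 2)) 1) ∅ 2 :=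
    FinRelHomology.empty_of_absolute hfin hZ
  refine ⟨h, ?_⟩
  rw [h.relEuler_empty_eq_sum]
  simp only [Finset.sum_range_succ, Finset.sum_range_zero]
  rw [e0.toLinearEquiv.finrank_eq, e1.toLinearEquiv.finrank_eq, finrank_ulift_int]
  norm_num

/-- **`χ = 1` for a contractible space** with finiteness: `H₀ ≅ ℤ` (path connected, the augmentation)
and `Hₖ = 0` for `k > 0` (Hatcher 2002, Prop. 2.7, Ex. 2.8). [folklore] -/
theorem finRelHomology_and_relEuler_of_contractibleSpace (X : Type) [TopologicalSpace X] [ContractibleSpace X] :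
    FinRelHomology ℤ ℤ X ∅ 1 ∧ relEuler ℤ ℤ X ∅ = 1 := by
  haveI := singularHomology.isIso_ε_of_pathConnectedSpace ℤ ℤ (X := X)
  let e0 : singularHomology ℤ ℤ X 0 ≅ ModuleCat.of ℤ (ULift.{0} ℤ) := asIso (singularHomology.ε ℤ ℤ X)
  have hZ : ∀ k, 1 ≤ k → IsZero (singularHomology ℤ ℤ X k) := fun k hk =>
    isZero_singularHomology_of_contractibleSpace ℤ ℤ (by omega)
  have hfin : ∀ k, Module.Finite ℤ (singularHomology ℤ ℤ X k) := by
    intro k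
    rcases Nat.eq_zero_or_pos k with rfl | hk
    · exact Module.Finite.equiv e0.toLinearEquiv.symm
    · exact finite_of_isZero (hZ k hk)
  have h : FinRelHomology ℤ ℤ X ∅ 1 := FinRelHomology.empty_of_absolute hfin hZ
  refine ⟨h, ?_⟩
  rw [h.relEuler_empty_eq_sum]
  simp only [Finset.sum_range_succ, Finset.sum_range_zero]
  rw [e0.toLinearEquiv.finrank_eq, finrank_ulift_int]
  norm_num

end General

/-! ## The model pieces of a 2-handle in `D^{m+2}`: tube, punctured tube, handle piece -/

section Model

variable {m : ℕ}

/-- A convex combination of two positive reals is positive. [folklore] -/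
theorem convexCombo_pos {t p q : ℝ} (ht0 : 0 ≤ t) (ht1 : t ≤ 1) (hp : 0 < p) (hq : 0 < q) :
    0 < (1 - t) * p + t * q := by
  rcases eq_or_lt_of_le ht1 with rfl | h
  · simpa using hq
  · nlinarith [mul_nonneg ht0 hq.le]

/-- `‖x_λ‖ ≤ ‖x‖`. [folklore] -/
theorem norm_lamPart₂_le (x : EuclideanSpace ℝ (Fin (m + 2))) : ‖lamPart₂ m x‖ ≤ ‖x‖ := by
  refine le_of_not_gt fun h => ?_
  have h1 := norm_sq_eq_lamPart₂_muPartG (m := m) x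
  nlinarith [mul_self_lt_mul_self (norm_nonneg x) h, norm_nonneg (muPartG m x), sq_nonneg ‖muPartG m x‖]

/-- `‖(u, 0)‖ = ‖u‖` for the `λ`-embedding. [folklore] -/
theorem norm_lamEmbed₂ (u : EuclideanSpace ℝ (Fin 2)) : ‖lamEmbed₂ m u‖ = ‖u‖ := by
  have h : ‖lamEmbed₂ m u‖ ^ 2 = ‖u‖ ^ 2 := by
    simpa only [map_zero, add_zero, norm_zero, ne_eq, OfNat.ofNat_ne_zero, not_false_eq_true, zero_pow]
      using norm_lamEmbed₂_add_muEmbedG_sq (m := m) u 0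
  exact (pow_left_inj₀ (norm_nonneg _) (norm_nonneg _) two_ne_zero).1 h

/-- **The (punctured) tube is homotopy equivalent to the circle**: for `b > 1/2` the subset
`{‖x‖ ≤ 1, 0 < ‖x_λ‖ < b}` of `ℝ^{m+2}` (`b = 2`: Kosinski's tube `T`; `b = 1`: `T ∖ S`) retracts by
straight lines onto the circle `{(θ/2, 0)}`, the angle `x ↦ x_λ/‖x_λ‖` being a homotopy inverse of
`θ ↦ (θ/2, 0)` (Kosinski 1993, VI §6: `T` is a tubular neighbourhood of `S = S¹ × 0`). [folklore] -/
theorem nonempty_homotopyEquiv_tube_circle {b : ℝ} (hb : 1 / 2 < b) :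
    Nonempty (↥{x : EuclideanSpace ℝ (Fin (m + 2)) | ‖x‖ ≤ 1 ∧ 0 < ‖lamPart₂ m x‖ ∧ ‖lamPart₂ m x‖ < b} ≃ₕ
      ↥(Metric.sphere (0 : EuclideanSpace ℝ (Fin 2)) 1)) := by
  set A : Set (EuclideanSpace ℝ (Fin (m + 2))) := {x | ‖x‖ ≤ 1 ∧ 0 < ‖lamPart₂ m x‖ ∧ ‖lamPart₂ m x‖ < b}
  -- the angle `x ↦ x_λ / ‖x_λ‖`
  have hf_mem : ∀ x : ↥A, ‖lamPart₂ m x.1‖⁻¹ • lamPart₂ m x.1 ∈ Metric.sphere (0 : EuclideanSpace ℝ (Fin 2)) 1 :=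
    fun x => by rw [mem_sphere_zero_iff_norm, norm_smul, norm_inv, norm_norm, inv_mul_cancel₀ x.2.2.1.ne']
  have hlc : Continuous fun x : ↥A => lamPart₂ m x.1 := (lamPart₂ m).continuous.comp continuous_subtype_val
  let f : C(↥A, ↥(Metric.sphere (0 : EuclideanSpace ℝ (Fin 2)) 1)) :=
    ⟨fun x => ⟨‖lamPart₂ m x.1‖⁻¹ • lamPart₂ m x.1, hf_mem x⟩,
      ((hlc.norm.inv₀ fun x => x.2.2.1.ne').smul hlc).subtype_mk _⟩
  -- the section `θ ↦ (θ/2, 0)`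
  have hg_mem : ∀ θ : ↥(Metric.sphere (0 : EuclideanSpace ℝ (Fin 2)) 1),
      (1 / 2 : ℝ) • lamEmbed₂ m θ.1 ∈ A := fun θ => by
    have hθ : ‖(θ : EuclideanSpace ℝ (Fin 2))‖ = 1 := mem_sphere_zero_iff_norm.1 θ.2
    have h1 : ‖(1 / 2 : ℝ) • lamEmbed₂ m θ.1‖ = 1 / 2 := by
      rw [norm_smul, norm_lamEmbed₂, hθ, mul_one, Real.norm_eq_abs, abs_of_pos (by norm_num)]
    have h2 : ‖lamPart₂ m ((1 / 2 : ℝ) • lamEmbed₂ m θ.1)‖ = 1 / 2 := by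
      rw [map_smul, lamPart₂_lamEmbed₂, norm_smul, hθ, mul_one, Real.norm_eq_abs, abs_of_pos (by norm_num)]
    refine ⟨by rw [h1]; norm_num, by rw [h2]; norm_num, by rw [h2]; exact hb⟩
  have hgc' : Continuous fun θ : ↥(Metric.sphere (0 : EuclideanSpace ℝ (Fin 2)) 1) => lamEmbed₂ m θ.1 :=
    (lamEmbed₂ m).continuous.comp continuous_subtype_val
  have hgc : Continuous fun θ : ↥(Metric.sphere (0 : EuclideanSpace ℝ (Fin 2)) 1) =>
      (1 / 2 : ℝ) • lamEmbed₂ m θ.1 := by fun_prop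
  let g : C(↥(Metric.sphere (0 : EuclideanSpace ℝ (Fin 2)) 1), ↥A) :=
    ⟨fun θ => ⟨(1 / 2 : ℝ) • lamEmbed₂ m θ.1, hg_mem θ⟩, hgc.subtype_mk _⟩
  -- `f ∘ g = 𝟙`
  have hfg : f.comp g = ContinuousMap.id _ := by
    ext θ : 2
    have hθ : ‖(θ : EuclideanSpace ℝ (Fin 2))‖ = 1 := mem_sphere_zero_iff_norm.1 θ.2
    change (Subtype.val (f (g θ))) = θ.1
    simp only [f, g, ContinuousMap.coe_mk, map_smul, lamPart₂_lamEmbed₂, norm_smul, hθ, mul_one,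
      Real.norm_eq_abs, smul_smul]
    rw [abs_of_pos (by norm_num : (0 : ℝ) < 1 / 2)]
    norm_num
  -- `g ∘ f ≃ 𝟙` by straight lines
  have hseg : ∀ (t : ℝ), 0 ≤ t → t ≤ 1 → ∀ x : ↥A, t • x.1 + (1 - t) • (g (f x)).1 ∈ A := by
    intro t ht0 ht1 x
    obtain ⟨hx1, hx0, hxb⟩ := x.2
    set y : EuclideanSpace ℝ (Fin (m + 2)) := (g (f x)).1 with hy
    have hyA : y ∈ A := (g (f x)).2
    have hyl : lamPart₂ m y = ((1 / 2 : ℝ) * ‖lamPart₂ m x.1‖⁻¹) • lamPart₂ m x.1 := by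
      simp only [hy, g, f, ContinuousMap.coe_mk, map_smul, lamPart₂_lamEmbed₂, smul_smul]
    have hl : lamPart₂ m (t • x.1 + (1 - t) • y) =
        (t + (1 - t) * ((1 / 2 : ℝ) * ‖lamPart₂ m x.1‖⁻¹)) • lamPart₂ m x.1 := by
      rw [map_add, map_smul, map_smul, hyl, smul_smul, ← add_smul]
    have hcoef : 0 ≤ t + (1 - t) * ((1 / 2 : ℝ) * ‖lamPart₂ m x.1‖⁻¹) := by
      have : 0 ≤ (1 / 2 : ℝ) * ‖lamPart₂ m x.1‖⁻¹ := by positivity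
      nlinarith
    have hnorm : ‖lamPart₂ m (t • x.1 + (1 - t) • y)‖ = t * ‖lamPart₂ m x.1‖ + (1 - t) * (1 / 2) := by
      rw [hl, norm_smul, Real.norm_eq_abs, abs_of_nonneg hcoef]
      field_simp
    refine ⟨?_, ?_, ?_⟩
    · calc ‖t • x.1 + (1 - t) • y‖ ≤ ‖t • x.1‖ + ‖(1 - t) • y‖ := norm_add_le _ _
        _ = t * ‖x.1‖ + (1 - t) * ‖y‖ := by
          rw [norm_smul, norm_smul, Real.norm_eq_abs, Real.norm_eq_abs, abs_of_nonneg ht0,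
            abs_of_nonneg (sub_nonneg.2 ht1)]
        _ ≤ t * 1 + (1 - t) * 1 :=
          add_le_add (mul_le_mul_of_nonneg_left hx1 ht0) (mul_le_mul_of_nonneg_left hyA.1 (sub_nonneg.2 ht1))
        _ = 1 := by ring
    · rw [hnorm]
      have := convexCombo_pos (sub_nonneg.2 ht1) (sub_le_self 1 ht0) hx0 (by norm_num : (0 : ℝ) < 1 / 2)
      nlinarith
    · rw [hnorm]
      have := convexCombo_pos (sub_nonneg.2 ht1) (sub_le_self 1 ht0) (sub_pos.2 hxb) (sub_pos.2 hb)
      nlinarith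
  let H : (g.comp f).Homotopy (ContinuousMap.id ↥A) :=
    { toFun := fun p => ⟨(p.1 : ℝ) • p.2.1 + (1 - (p.1 : ℝ)) • (g (f p.2)).1,
        hseg p.1 p.1.2.1 p.1.2.2 p.2⟩
      continuous_toFun := by
        refine Continuous.subtype_mk ?_ _
        have h1 : Continuous fun p : I × ↥A => (p.1 : ℝ) := continuous_induced_dom.comp continuous_fst
        have h2 : Continuous fun p : I × ↥A => (p.2 : EuclideanSpace ℝ (Fin (m + 2))) :=
          continuous_subtype_val.comp continuous_snd
        have h3 : Continuous fun p : I × ↥A => ((g (f p.2)) : EuclideanSpace ℝ (Fin (m + 2))) :=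
          continuous_subtype_val.comp ((g.comp f).continuous.comp continuous_snd)
        exact (h1.smul h2).add ((continuous_const.sub h1).smul h3)
      map_zero_left := fun x => by
        ext : 1
        simp
      map_one_left := fun x => by
        ext : 1
        simp }
  exact ⟨{ toFun := f
           invFun := g
           left_inv := ⟨H⟩
           right_inv := by rw [hfg] }⟩

/-- **`χ = 0` for the tube `{0 < ‖x_λ‖ < b}` in the unit ball** (`b > 1/2`), with finiteness
(homotopy equivalent to `S¹`). [folklore] -/
theorem finRelHomology_and_relEuler_tube {b : ℝ} (hb : 1 / 2 < b) :
    FinRelHomology ℤ ℤ ↥{x : EuclideanSpace ℝ (Fin (m + 2)) | ‖x‖ ≤ 1 ∧ 0 < ‖lamPart₂ m x‖ ∧ ‖lamPart₂ m x‖ < b}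
        ∅ 2 ∧
      relEuler ℤ ℤ ↥{x : EuclideanSpace ℝ (Fin (m + 2)) | ‖x‖ ≤ 1 ∧ 0 < ‖lamPart₂ m x‖ ∧ ‖lamPart₂ m x‖ < b}
        ∅ = 0 := by
  obtain ⟨e⟩ := nonempty_homotopyEquiv_tube_circle (m := m) hb
  obtain ⟨h, he⟩ := finRelHomology_and_relEuler_of_homotopyEquiv e finRelHomology_and_relEuler_circle.1
  exact ⟨h, he.trans finRelHomology_and_relEuler_circle.2⟩

/-- **`χ = 1` for the handle piece `{‖x‖ ≤ 1, ‖x_λ‖ < 1}`** (the image of `D^{m+2} ∖ S`), with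
finiteness: it is star-shaped about the centre, hence contractible. [folklore] -/
theorem finRelHomology_and_relEuler_beltSet :
    FinRelHomology ℤ ℤ ↥{x : EuclideanSpace ℝ (Fin (m + 2)) | ‖x‖ ≤ 1 ∧ ‖lamPart₂ m x‖ < 1} ∅ 1 ∧
      relEuler ℤ ℤ ↥{x : EuclideanSpace ℝ (Fin (m + 2)) | ‖x‖ ≤ 1 ∧ ‖lamPart₂ m x‖ < 1} ∅ = 1 := by
  have hstar : StarConvex ℝ (0 : EuclideanSpace ℝ (Fin (m + 2)))
      {x | ‖x‖ ≤ 1 ∧ ‖lamPart₂ m x‖ < 1} := by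
    intro y hy a c ha hc hac
    rw [smul_zero, zero_add]
    have hc1 : c ≤ 1 := by linarith
    refine ⟨?_, ?_⟩
    · rw [norm_smul, Real.norm_eq_abs, abs_of_nonneg hc]
      nlinarith [hy.1, norm_nonneg y]
    · rw [map_smul, norm_smul, Real.norm_eq_abs, abs_of_nonneg hc]
      nlinarith [hy.2, norm_nonneg (lamPart₂ m y)]
  haveI := hstar.contractibleSpace ⟨0, by simp⟩
  exact finRelHomology_and_relEuler_of_contractibleSpace _

/-- The conditions `|x_λ|² ≠ 0`, `|x_λ|² ≠ 1` on the unit ball, read through `‖x_λ‖`. [folklore] -/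
theorem lamSq_ne_iff (x : EuclideanSpace ℝ (Fin (m + 2))) (hx : ‖x‖ ≤ 1) :
    (lamSq 2 x ≠ 0 ↔ 0 < ‖lamPart₂ m x‖) ∧ (lamSq 2 x ≠ 1 ↔ ‖lamPart₂ m x‖ < 1) ∧ ‖lamPart₂ m x‖ ≤ 1 := by
  have hle : ‖lamPart₂ m x‖ ≤ 1 := (norm_lamPart₂_le x).trans hx
  rw [lamSq_two_eq]
  refine ⟨?_, ?_, hle⟩
  · rw [← not_iff_not, not_not, not_lt, sq_eq_zero_iff, norm_eq_zero]
    constructor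
    · intro h; rw [h, norm_zero]
    · intro h; exact norm_eq_zero.1 (le_antisymm h (norm_nonneg _))
  · constructor
    · intro h
      exact lt_of_le_of_ne hle fun h1 => h (by rw [h1, one_pow])
    · intro h h1
      have : ‖lamPart₂ m x‖ = 1 := by
        have h2 : ‖lamPart₂ m x‖ ^ 2 = 1 ^ 2 := by rw [h1, one_pow]
        exact (pow_left_inj₀ (norm_nonneg _) zero_le_one two_ne_zero).1 h2
      exact h.ne this

/-- **`χ(T) = 0` for Kosinski's tube `T = {x ∈ D^{m+2} | x_λ ≠ 0}`** (as a space), with finiteness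
bounded by `2`: `T` is a copy of the model tube `{‖x‖ ≤ 1, 0 < ‖x_λ‖ < 2}`. [folklore] -/
theorem finRelHomology_and_relEuler_handleTube :
    FinRelHomology ℤ ℤ ↥(handleTube (m + 1) 2) ∅ 2 ∧ relEuler ℤ ℤ ↥(handleTube (m + 1) 2) ∅ = 0 := by
  have hemb : Topology.IsEmbedding fun y : ↥(handleTube (m + 1) 2) => tubeVecG m y :=
    Topology.IsEmbedding.subtypeVal.comp Topology.IsEmbedding.subtypeVal
  have hr : range (fun y : ↥(handleTube (m + 1) 2) => tubeVecG m y) =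
      {x : EuclideanSpace ℝ (Fin (m + 2)) | ‖x‖ ≤ 1 ∧ 0 < ‖lamPart₂ m x‖ ∧ ‖lamPart₂ m x‖ < 2} := by
    ext x
    constructor
    · rintro ⟨y, rfl⟩
      have hx : ‖tubeVecG m y‖ ≤ 1 := norm_tubeVecG_le_one y
      obtain ⟨h0, -, hle⟩ := lamSq_ne_iff (tubeVecG m y) hx
      exact ⟨hx, h0.1 y.2, by linarith⟩
    · rintro ⟨hx, h0, -⟩
      exact ⟨⟨⟨x, mem_closedBall_zero_iff.2 hx⟩, (lamSq_ne_iff x hx).1.2 h0⟩, rfl⟩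
  let e := hemb.toHomeomorph.trans (Homeomorph.setCongr hr)
  obtain ⟨h, he⟩ := finRelHomology_and_relEuler_tube (m := m) (b := 2) (by norm_num)
  exact ⟨h.of_homeomorph e.symm (mapsTo_empty _ _) (mapsTo_empty _ _),
    (relEuler_eq_of_homeomorph e (mapsTo_empty _ _) (mapsTo_empty _ _)).trans he⟩

/-- **`χ(T ∖ S) = 0` for the punctured tube** (inside `T`: `|x_λ|² ≠ 1`), with finiteness bounded by `2`:
a copy of the model tube `{‖x‖ ≤ 1, 0 < ‖x_λ‖ < 1}`. [folklore] -/
theorem finRelHomology_and_relEuler_handleTube_punctured :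
    FinRelHomology ℤ ℤ ↥{y : ↥(handleTube (m + 1) 2) | lamSq 2 (tubeVecG m y) ≠ 1} ∅ 2 ∧
      relEuler ℤ ℤ ↥{y : ↥(handleTube (m + 1) 2) | lamSq 2 (tubeVecG m y) ≠ 1} ∅ = 0 := by
  set P := {y : ↥(handleTube (m + 1) 2) | lamSq 2 (tubeVecG m y) ≠ 1}
  have hemb : Topology.IsEmbedding fun y : ↥P => tubeVecG m y.1 :=
    (Topology.IsEmbedding.subtypeVal.comp Topology.IsEmbedding.subtypeVal).comp Topology.IsEmbedding.subtypeVal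
  have hr : range (fun y : ↥P => tubeVecG m y.1) = {x | ‖x‖ ≤ 1 ∧ 0 < ‖lamPart₂ m x‖ ∧ ‖lamPart₂ m x‖ < 1} := by
    ext x
    constructor
    · rintro ⟨y, rfl⟩
      obtain ⟨h0, h1, -⟩ := lamSq_ne_iff (tubeVecG m y.1) (norm_tubeVecG_le_one y.1)
      exact ⟨norm_tubeVecG_le_one y.1, h0.1 y.1.2, h1.1 y.2⟩
    · rintro ⟨hx, h0, h1⟩
      exact ⟨⟨⟨⟨x, mem_closedBall_zero_iff.2 hx⟩, (lamSq_ne_iff x hx).1.2 h0⟩, (lamSq_ne_iff x hx).2.1.2 h1⟩, rfl⟩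
  let e := hemb.toHomeomorph.trans (Homeomorph.setCongr hr)
  obtain ⟨h, he⟩ := finRelHomology_and_relEuler_tube (m := m) (b := 1) (by norm_num)
  exact ⟨h.of_homeomorph e.symm (mapsTo_empty _ _) (mapsTo_empty _ _),
    (relEuler_eq_of_homeomorph e (mapsTo_empty _ _) (mapsTo_empty _ _)).trans he⟩

/-- **`χ = 0` for the gluing region `{x_λ ≠ 0}` of the handle piece `D ∖ S`**, with finiteness bounded by
`2`: a copy of the model tube `{‖x‖ ≤ 1, 0 < ‖x_λ‖ < 1}`. [folklore] -/
theorem finRelHomology_and_relEuler_beltPiece_punctured :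
    FinRelHomology ℤ ℤ ↥{b : ↥(beltPiece (m + 1) 2) | lamSq 2 ((b : Metric.closedBall (0 : EuclideanSpace ℝ (Fin (m + 2))) 1) :
        EuclideanSpace ℝ (Fin (m + 2))) ≠ 0} ∅ 2 ∧
      relEuler ℤ ℤ ↥{b : ↥(beltPiece (m + 1) 2) | lamSq 2 ((b : Metric.closedBall (0 : EuclideanSpace ℝ (Fin (m + 2))) 1) :
        EuclideanSpace ℝ (Fin (m + 2))) ≠ 0} ∅ = 0 := by
  set P := {b : ↥(beltPiece (m + 1) 2) | lamSq 2 ((b : Metric.closedBall (0 : EuclideanSpace ℝ (Fin (m + 2))) 1) :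
    EuclideanSpace ℝ (Fin (m + 2))) ≠ 0}
  have hemb : Topology.IsEmbedding fun b : ↥P =>
      ((b.1 : Metric.closedBall (0 : EuclideanSpace ℝ (Fin (m + 2))) 1) : EuclideanSpace ℝ (Fin (m + 2))) :=
    (Topology.IsEmbedding.subtypeVal.comp Topology.IsEmbedding.subtypeVal).comp Topology.IsEmbedding.subtypeVal
  have hr : range (fun b : ↥P => ((b.1 : Metric.closedBall (0 : EuclideanSpace ℝ (Fin (m + 2))) 1) :
      EuclideanSpace ℝ (Fin (m + 2)))) = {x | ‖x‖ ≤ 1 ∧ 0 < ‖lamPart₂ m x‖ ∧ ‖lamPart₂ m x‖ < 1} := by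
    ext x
    constructor
    · rintro ⟨b, rfl⟩
      have hx := mem_closedBall_zero_iff.1 b.1.1.2
      obtain ⟨h0, h1, -⟩ := lamSq_ne_iff _ hx
      exact ⟨hx, h0.1 b.2, h1.1 b.1.2⟩
    · rintro ⟨hx, h0, h1⟩
      exact ⟨⟨⟨⟨x, mem_closedBall_zero_iff.2 hx⟩, (lamSq_ne_iff x hx).2.1.2 h1⟩, (lamSq_ne_iff x hx).1.2 h0⟩, rfl⟩
  let e := hemb.toHomeomorph.trans (Homeomorph.setCongr hr)
  obtain ⟨h, he⟩ := finRelHomology_and_relEuler_tube (m := m) (b := 1) (by norm_num)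
  exact ⟨h.of_homeomorph e.symm (mapsTo_empty _ _) (mapsTo_empty _ _),
    (relEuler_eq_of_homeomorph e (mapsTo_empty _ _) (mapsTo_empty _ _)).trans he⟩

/-- **`χ(D ∖ S) = 1` for the handle piece**, with finiteness bounded by `1`: a copy of the star-shaped
model `{‖x‖ ≤ 1, ‖x_λ‖ < 1}`. [folklore] -/
theorem finRelHomology_and_relEuler_beltPiece :
    FinRelHomology ℤ ℤ ↥(beltPiece (m + 1) 2) ∅ 1 ∧ relEuler ℤ ℤ ↥(beltPiece (m + 1) 2) ∅ = 1 := by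
  have hemb : Topology.IsEmbedding fun b : ↥(beltPiece (m + 1) 2) =>
      ((b : Metric.closedBall (0 : EuclideanSpace ℝ (Fin (m + 2))) 1) : EuclideanSpace ℝ (Fin (m + 2))) :=
    Topology.IsEmbedding.subtypeVal.comp Topology.IsEmbedding.subtypeVal
  have hr : range (fun b : ↥(beltPiece (m + 1) 2) =>
      ((b : Metric.closedBall (0 : EuclideanSpace ℝ (Fin (m + 2))) 1) : EuclideanSpace ℝ (Fin (m + 2)))) =
      {x : EuclideanSpace ℝ (Fin (m + 2)) | ‖x‖ ≤ 1 ∧ ‖lamPart₂ m x‖ < 1} := by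
    ext x
    constructor
    · rintro ⟨b, rfl⟩
      have hx : ‖((b : Metric.closedBall (0 : EuclideanSpace ℝ (Fin (m + 2))) 1) : EuclideanSpace ℝ (Fin (m + 2)))‖ ≤ 1 :=
        mem_closedBall_zero_iff.1 b.1.2
      exact ⟨hx, (lamSq_ne_iff _ hx).2.1.1 b.2⟩
    · rintro ⟨hx, h1⟩
      exact ⟨⟨⟨x, mem_closedBall_zero_iff.2 hx⟩, (lamSq_ne_iff x hx).2.1.2 h1⟩, rfl⟩
  let e := hemb.toHomeomorph.trans (Homeomorph.setCongr hr)
  obtain ⟨h, he⟩ := finRelHomology_and_relEuler_beltSet (m := m)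
  exact ⟨h.of_homeomorph e.symm (mapsTo_empty _ _) (mapsTo_empty _ _),
    (relEuler_eq_of_homeomorph e (mapsTo_empty _ _) (mapsTo_empty _ _)).trans he⟩

/-- **The registered sub-goal `stub_modelsOn_counts_eulerHandleModels`** (sub-goal of `stub_modelsOn_counts`,
line `modp-braid-orbits`, r9): the four model Euler characteristics of a 2-handle in every dimension `m + 2`
— `χ(T) = 0`, `χ(T ∖ S) = 0`, `χ(D ∖ S) = 1`, `χ({x_λ ≠ 0} ⊆ D ∖ S) = 0` — in the shape consumed by
`relEuler_of_isMultiAttachment_four` / `finRelHomology_and_relEuler_coresComplement` of `…EulerHandles.lean`.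
[folklore] -/
theorem stub_modelsOn_counts_eulerHandleModels :
    ∀ m : ℕ,
      (FinRelHomology ℤ ℤ ↥(handleTube (m + 1) 2) ∅ 2 ∧ relEuler ℤ ℤ ↥(handleTube (m + 1) 2) ∅ = 0) ∧
      (FinRelHomology ℤ ℤ ↥{y : ↥(handleTube (m + 1) 2) | lamSq 2 (tubeVecG m y) ≠ 1} ∅ 2 ∧
        relEuler ℤ ℤ ↥{y : ↥(handleTube (m + 1) 2) | lamSq 2 (tubeVecG m y) ≠ 1} ∅ = 0) ∧
      (FinRelHomology ℤ ℤ ↥(beltPiece (m + 1) 2) ∅ 1 ∧ relEuler ℤ ℤ ↥(beltPiece (m + 1) 2) ∅ = 1) ∧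
      (FinRelHomology ℤ ℤ ↥{b : ↥(beltPiece (m + 1) 2) | lamSq 2 ((b : Metric.closedBall (0 : EuclideanSpace ℝ (Fin (m + 2))) 1) :
          EuclideanSpace ℝ (Fin (m + 2))) ≠ 0} ∅ 2 ∧
        relEuler ℤ ℤ ↥{b : ↥(beltPiece (m + 1) 2) | lamSq 2 ((b : Metric.closedBall (0 : EuclideanSpace ℝ (Fin (m + 2))) 1) :
          EuclideanSpace ℝ (Fin (m + 2))) ≠ 0} ∅ = 0) :=
  fun _ => ⟨finRelHomology_and_relEuler_handleTube, finRelHomology_and_relEuler_handleTube_punctured,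
    finRelHomology_and_relEuler_beltPiece, finRelHomology_and_relEuler_beltPiece_punctured⟩

end Model

end Summit.SmoothPoincare4.SmoothPoincare4.Theorems.AcyclicBisectionExists.ModpBraidOrbits

end
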